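/-
Copyright (c) 2026 the pub-hodgecm-mathlib formalisation cell (harness21).  Prover seat hodgecm-mathlib-K2Liu-p11 (g0), Track B «K2-LIT»,
#184♮ = hLiu418 = `stmt-HodgeConjecture-24832`; LEAD F0P6-plan (g12) RULING M-156n (4) «A∞ ORGAN»; K2E5-plan (g6) 08:24:53Z «=».
File (A∞-0a): tube-frame prerequisites of the archimedean Siegel sections, stated WITHOUT the (D∞) definitions (so it checks before the
definition-lane leaf `K2LiuArchInducedTubeDefs` lands).  THEOREMS ONLY (no `def`, no `instance`, no notation, no named-fact hypothesis, no `sorry`).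
-/
import Summits.HodgeConjecture.HodgeConjecture.Theorems.K2LiuHermitianTubeAction
import Mathlib.Analysis.SpecialFunctions.Pow.Complex
import HarnessLib

/-!
# Crux `HLiu418`, A∞ organ, (A∞-0a): the automorphy factor on the Siegel parabolic and on `Stab(i·1)`, and the parabolic law of
# the scalar-type vector `j(g,i1)^{−k} ‖j(g,i1)‖^{k−2s−l}`

Cell `hodgecm-mathlib`, crux item hLiu418 = `stmt-HodgeConjecture-24832` (helper lane `--supports`, count-neutral).
* `det_denom_mul_of_siegel`: for `p` in the Siegel parabolic (`p₂₁ = 0`) and ANY `g`, `j(p g, i1) = det p₂₂ · j(g, i1)` (★ `denom_mul`);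
* `toBlocks₂₂_eq_of_mem_siegel`: for `p ∈ U(J) ∩ P_Δ`, `p₂₂ = (p₁₁ᴴ)⁻¹` and `det p₁₁ ≠ 0` (★ `blocks_rel`); hence
  `det p₂₂ = (conj (det p₁₁))⁻¹` (`det_toBlocks₂₂_of_mem_siegel`);
* `norm_det_denom_of_stab`: for `u ∈ U(J)` fixing `i·1`, `‖j(u, i1)‖ = 1` (★ `conjTranspose_denom_mul_im_moeb_mul_denom`: `denom u (i1)` is unitary);
* `scalarSection_parabolic`: the PARABOLIC LAW `f⁰(p g) = χ_k(det p₁₁) · ‖det p₁₁‖^{2s+l} · f⁰(g)`, `χ_k(z) = (z̄ ∕ ‖z‖)^k`, for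
  `f⁰(g) = j(g,i1)^{−k} ‖j(g,i1)‖^{k−2s−l}` written out (the `IsArchSiegelSection (χ_k) s (archScalarSection k s)` of (D∞), folded in (A∞-0b));
* `scalarSection_mul_stab`: the `K_w`-TYPE LAW `f⁰(g u) = j(u,i1)^{−k} f⁰(g)` for `g ∈ U(J)`, `u ∈ Stab(i1) ∩ U(J)`.
References: [Shimura1997, §§5–6, §16].
HONEST LABEL: HC_CM is proved only modulo the 7 printed citations (2 remaining named inputs: hLiu418 = stmt-HodgeConjecture-24832,
h413 = stmt-HodgeConjecture-24833) until rung 0 closes; count-neutral helper, closes no socket.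
-/

set_option autoImplicit false
set_option linter.dupNamespace false

noncomputable section

open scoped Matrix ComplexConjugate ComplexOrder
open Complex Matrix
open Literature.NumberTheory.ModularForms.SiegelUpperHalfSpace (num denom moeb denom_def denom_mul)
open Summit.HodgeConjecture.HodgeConjecture.Cruxes.HLiu418.K2LiuHermitianTubeCocycle
open Summit.HodgeConjecture.HodgeConjecture.Cruxes.HLiu418.K2LiuHermitianTubeAction

namespace Summit.HodgeConjecture.HodgeConjecture.Cruxes.HLiu418.K2LiuArchInducedTubeSectionPrelims

variable {l : Type*} [Fintype l] [DecidableEq l]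

/-! ## 1. The automorphy factor on the Siegel parabolic -/

/-- For `p` in the Siegel parabolic and any `g`: `denom (p g) (i1) = p₂₂ · denom g (i1)`. [cite: Shimura1997, §5.2] -/
theorem denom_mul_of_siegel {p : Matrix (l ⊕ l) (l ⊕ l) ℂ} (hp : p.toBlocks₂₁ = 0) (g : Matrix (l ⊕ l) (l ⊕ l) ℂ) :
    denom (p * g) (I • (1 : Matrix l l ℂ)) = p.toBlocks₂₂ * denom g (I • 1) := by
  rw [denom_mul, hp, Matrix.zero_mul, zero_add]

/-- `j(p g, i1) = det p₂₂ · j(g, i1)` for `p` in the Siegel parabolic. [cite: Shimura1997, §5.2] -/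
theorem det_denom_mul_of_siegel {p : Matrix (l ⊕ l) (l ⊕ l) ℂ} (hp : p.toBlocks₂₁ = 0) (g : Matrix (l ⊕ l) (l ⊕ l) ℂ) :
    (denom (p * g) (I • (1 : Matrix l l ℂ))).det = p.toBlocks₂₂.det * (denom g (I • (1 : Matrix l l ℂ))).det := by
  rw [denom_mul_of_siegel hp, det_mul]

/-- For `p ∈ U(J) ∩ P_Δ`: `p₁₁ᴴ p₂₂ = 1`, so `det p₁₁ ≠ 0` and `det p₂₂ = (conj (det p₁₁))⁻¹`. [cite: Shimura1997, §5.1] -/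
theorem det_toBlocks₂₂_of_mem_siegel {p : Matrix (l ⊕ l) (l ⊕ l) ℂ} (hP : pᴴ * Matrix.J l ℂ * p = Matrix.J l ℂ) (hp : p.toBlocks₂₁ = 0) :
    p.toBlocks₁₁.det ≠ 0 ∧ p.toBlocks₂₂.det = (conj p.toBlocks₁₁.det)⁻¹ := by
  obtain ⟨-, -, h3, -⟩ := blocks_rel hP
  rw [hp, conjTranspose_zero, Matrix.zero_mul, sub_zero] at h3
  have hdet := congrArg det h3
  rw [det_mul, det_conjTranspose, det_one] at hdet
  have hne : p.toBlocks₁₁.det ≠ 0 := by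
    intro h0
    rw [h0, star_zero, zero_mul] at hdet
    exact zero_ne_one hdet
  refine ⟨hne, ?_⟩
  have hcne : conj p.toBlocks₁₁.det ≠ 0 := by rwa [map_ne_zero]
  rw [Complex.star_def] at hdet
  exact eq_inv_of_mul_eq_one_right hdet

/-! ## 2. The automorphy factor on the stabiliser of the base point -/

/-- For `u ∈ U(J)` fixing `i·1`, `denom u (i1)` is unitary, hence `‖j(u, i1)‖ = 1`. [cite: Shimura1997, §6.5] -/
theorem norm_det_denom_of_stab {u : Matrix (l ⊕ l) (l ⊕ l) ℂ} (hU : uᴴ * Matrix.J l ℂ * u = Matrix.J l ℂ)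
    (hI : moeb u (I • (1 : Matrix l l ℂ)) = I • 1) : ‖(denom u (I • (1 : Matrix l l ℂ))).det‖ = 1 := by
  have h := conjTranspose_denom_mul_im_moeb_mul_denom hU (Z := I • (1 : Matrix l l ℂ)) posDef_im_I_smul_one
  rw [hI, im_I_smul_one, Matrix.mul_one] at h
  have hdet := congrArg det h
  rw [det_mul, det_conjTranspose, det_one, Complex.star_def, Complex.conj_mul'] at hdet
  have hsq : ‖(denom u (I • (1 : Matrix l l ℂ))).det‖ ^ 2 = 1 := by exact_mod_cast hdet
  nlinarith [norm_nonneg ((denom u (I • (1 : Matrix l l ℂ))).det), hsq]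

/-! ## 3. The scalar-type vector: parabolic law and `K_w`-type -/

/-- **PARABOLIC LAW** of `f⁰_{s,k}(g) = j(g,i1)^{−k} ‖j(g,i1)‖^{k−2s−l}` (written out): for `p ∈ U(J) ∩ P_Δ` and any `g`,
`f⁰(p g) = (conj d ∕ ‖d‖)^k · ‖d‖^{2s+l} · f⁰(g)` with `d = det p₁₁`. [cite: Shimura1997, §16.4] -/
theorem scalarSection_parabolic (k : ℤ) (s : ℂ) {p : Matrix (l ⊕ l) (l ⊕ l) ℂ} (hP : pᴴ * Matrix.J l ℂ * p = Matrix.J l ℂ)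
    (hp : p.toBlocks₂₁ = 0) (g : Matrix (l ⊕ l) (l ⊕ l) ℂ) :
    (denom (p * g) (I • (1 : Matrix l l ℂ))).det ^ (-k) *
        (((‖(denom (p * g) (I • (1 : Matrix l l ℂ))).det‖ : ℝ) : ℂ) ^ ((k : ℂ) - 2 * s - (Fintype.card l : ℂ))) =
      (conj p.toBlocks₁₁.det / ((‖p.toBlocks₁₁.det‖ : ℝ) : ℂ)) ^ k *
        (((‖p.toBlocks₁₁.det‖ : ℝ) : ℂ) ^ (2 * s + (Fintype.card l : ℂ))) *
        ((denom g (I • (1 : Matrix l l ℂ))).det ^ (-k) *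
          (((‖(denom g (I • (1 : Matrix l l ℂ))).det‖ : ℝ) : ℂ) ^ ((k : ℂ) - 2 * s - (Fintype.card l : ℂ)))) := by
  obtain ⟨hne, h22⟩ := det_toBlocks₂₂_of_mem_siegel hP hp
  set d : ℂ := p.toBlocks₁₁.det with hd
  set jg : ℂ := (denom g (I • (1 : Matrix l l ℂ))).det with hjg
  rw [det_denom_mul_of_siegel hp, h22, norm_mul, norm_inv, Complex.norm_conj, Complex.ofReal_mul,
    mul_zpow, Complex.mul_cpow_ofReal_nonneg (inv_nonneg.2 (norm_nonneg _)) (norm_nonneg _)]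
  -- the scalar factor
  have hn0 : ((‖d‖ : ℝ) : ℂ) ≠ 0 := by exact_mod_cast (norm_ne_zero_iff.2 hne)
  have hnpos : (0 : ℝ) < ‖d‖ := norm_pos_iff.2 hne
  have harg : (((‖d‖ : ℝ) : ℂ)).arg ≠ Real.pi := by
    rw [Complex.arg_ofReal_of_nonneg hnpos.le]; exact Real.pi_ne_zero.symm
  have hinv : (((‖d‖⁻¹ : ℝ)) : ℂ) ^ ((k : ℂ) - 2 * s - (Fintype.card l : ℂ)) =
      (((‖d‖ : ℝ) : ℂ) ^ ((k : ℂ) - 2 * s - (Fintype.card l : ℂ)))⁻¹ := by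
    rw [Complex.ofReal_inv, Complex.inv_cpow _ _ harg]
  have hfac : ((conj d)⁻¹) ^ (-k) * (((‖d‖⁻¹ : ℝ) : ℂ) ^ ((k : ℂ) - 2 * s - (Fintype.card l : ℂ))) =
      (conj d / ((‖d‖ : ℝ) : ℂ)) ^ k * (((‖d‖ : ℝ) : ℂ) ^ (2 * s + (Fintype.card l : ℂ))) := by
    rw [hinv, _root_.inv_zpow', neg_neg, div_zpow, div_eq_mul_inv, ← Complex.cpow_intCast ((‖d‖ : ℝ) : ℂ) k, mul_assoc]
    congr 1
    rw [← Complex.cpow_neg, ← Complex.cpow_neg, ← Complex.cpow_add _ _ hn0]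
    congr 1
    ring
  rw [← hfac]
  ring

/-- **`K_w`-TYPE LAW** of the scalar-type vector (written out): for `g ∈ U(J)` and `u ∈ U(J)` fixing `i·1`,
`f⁰(g u) = j(u, i1)^{−k} · f⁰(g)`. [cite: Shimura1997, §16.4] -/
theorem scalarSection_mul_stab (k : ℤ) (s : ℂ) {g u : Matrix (l ⊕ l) (l ⊕ l) ℂ} (hg : gᴴ * Matrix.J l ℂ * g = Matrix.J l ℂ)
    (hU : uᴴ * Matrix.J l ℂ * u = Matrix.J l ℂ) (hI : moeb u (I • (1 : Matrix l l ℂ)) = I • 1) :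
    (denom (g * u) (I • (1 : Matrix l l ℂ))).det ^ (-k) *
        (((‖(denom (g * u) (I • (1 : Matrix l l ℂ))).det‖ : ℝ) : ℂ) ^ ((k : ℂ) - 2 * s - (Fintype.card l : ℂ))) =
      (denom u (I • (1 : Matrix l l ℂ))).det ^ (-k) *
        ((denom g (I • (1 : Matrix l l ℂ))).det ^ (-k) *
          (((‖(denom g (I • (1 : Matrix l l ℂ))).det‖ : ℝ) : ℂ) ^ ((k : ℂ) - 2 * s - (Fintype.card l : ℂ)))) := by
  have _ := hg
  rw [det_denom_mul_of_posDef hU posDef_im_I_smul_one, hI, norm_mul, norm_det_denom_of_stab hU hI, mul_one, mul_zpow]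
  ring

end Summit.HodgeConjecture.HodgeConjecture.Cruxes.HLiu418.K2LiuArchInducedTubeSectionPrelims

end
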